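/-
Copyright (c) 2026 the pub-hodgecm-mathlib formalisation cell (harness21).  Prover seat hodgecm-mathlib-K2E4-p13 (g0),
Track B «K2-LIT» ∕ h413, ENGINE E4 unit U6 `ArchLimitConstant` — the (end) field of the G′ package of socket #9 `sig_K2E4ExplicitArchSingularTransfer`, COMPOSED:
(end) = (end-read) ★ `K2E4ArchGPrimeEndRead` ∘ (end-alg) ★ `K2E4ArchGPrimeEndAlg` (K2E4-p11 contract `K2E4ArchGPrimeSigs.contract.v1` 2f1b0eee520ac830, statement VERBATIM).  2026-09-03.
-/
import Summits.HodgeConjecture.HodgeConjecture.Theorems.K2E4ArchGPrimeEndRead   -- ★ (end-read) `exists_wallIntegral_eq_mul_classOrbitalIntegral`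
import Summits.HodgeConjecture.HodgeConjecture.Theorems.K2E4ArchGPrimeEndAlg    -- ★ p855388 (end-alg) `exists_gState_univ_eq_of_wallIntegral`
import HarnessLib

/-!
# K2 · E4 · U6, the G′ package of socket #9, (end): `gState(univ, u) = lam · Φ^{st}_∞(t z⁰, Θ∘coe; top-form family)`, `lam ≠ 0` universal
# (Rogawski 1990 §8.2 Prop. 8.2.1 (a) pp. 118–119, p. 124 «a non-zero constant times `Φ^st(γ₀, f)`»; §14.5 p. 238)

Cell `pub/hodgecm-mathlib` (D-0151), HCML Track B, crux H413 = `stmt-HodgeConjecture-24833`; prover seat `hodgecm-mathlib-K2E4-p13` (g0) for the packer K2E4-p09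
(`K2E4ArchGPrimeData.gPrimeData_nonempty`, field `end_eq` of ★ `GPrimeData`) and the `G′`-package owner K2E4-p11 (`--supports … --as helper`).  THE CONTRACT STATEMENT
`K2E4ArchGPrimeSigs.exists_gState_univ_eq` (K2E4-p11, `K2/K2E4-p11/g0/K2E4ArchGPrimeSigs.contract.v1.K2E4-p11-g0.lean` sha16 2f1b0eee520ac830) under exactly its name ∕ namespace ∕
binder order, so that the packer is an import swap.

PROOF = ★ (end-read) `K2E4ArchGPrimeEndRead.exists_wallIntegral_eq_mul_classOrbitalIntegral` (the wall-measure integral of every relabelling is `r ·` the top-form class orbital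
integral at `t(z⁰∘ρ)`, ONE `r ≠ 0`: ★ (P1) + ★ pins + ★ (W2) + ★ (U) + ★ atPoint) fed as `hread` to ★ (end-alg) `K2E4ArchGPrimeEndAlg.exists_gState_univ_eq_of_wallIntegral` (Δ on the
Cayley family ★ G2, κ-signed fibre sums `r`-free ★ (E-alg), regrouping of the class sum to `Φ^{st}_∞`).
HONEST LABEL: HC_CM is proved only modulo the 7 printed citations (2 remaining named inputs: hLiu418 = stmt-HodgeConjecture-24832, h413 = stmt-HodgeConjecture-24833) until rung 0 closes; this
file composes ★ bricks and pays no socket by itself (#9 is the packer's + assembler's).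

## References
* [Rogawski1990] J. D. Rogawski, *Automorphic Representations of Unitary Groups in Three Variables*, Ann. of Math. Stud. 123 (1990), §8.2 Prop. 8.2.1 (a) pp. 118–119, pp. 122–124;
  §14.5 p. 238; §4.3 (4.3.1) p. 43.
-/

set_option autoImplicit false
set_option linter.dupNamespace false  -- the cell's namespace convention `Summit.HodgeConjecture.HodgeConjecture.Cruxes.H413.<File>` repeats the summit = problem name

noncomputable section

open MeasureTheory Measure Filter Topology NumberField NumberField.InfinitePlace NumberField.mixedEmbedding Equiv Function Set
open Literature.MeasureTheory.Group Literature.NumberTheory.Automorphic Literature.NumberTheory.Automorphic.UnitaryGroup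
open Literature.LinearAlgebra.Matrix Literature.NumberTheory.Rogawski1990 Literature.NumberTheory.GaloisRepresentations IsDedekindDomain
open Summit.HodgeConjecture.HodgeConjecture.Cruxes.H413.K2E4ArchGPrimeDefs
open scoped Matrix MatrixGroups Matrix.Norms.Operator ContDiff ENNReal Classical

namespace Summit.HodgeConjecture.HodgeConjecture.Cruxes.H413.K2E4ArchGPrimeEnd

variable (L : Type) [Field L] [NumberField L] [IsCMField L] (α : Fin 3 → L) [MeasurableSpace (GL (Fin 3) ℂ)] [BorelSpace (GL (Fin 3) ℂ)]
  [MeasurableSpace (arch (↥(maximalRealSubfield L)) L (IsCMField.complexConj L) 3 (Matrix.diagonal α))]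
  [BorelSpace (arch (↥(maximalRealSubfield L)) L (IsCMField.complexConj L) 3 (Matrix.diagonal α))]

/-- **(end) THE FULLY DESCENDED STATE IS A NON-ZERO UNIVERSAL MULTIPLE OF THE UNSIGNED TOP-FORM STABLE SUM AT THE WALL TORUS POINT** — the field `end_eq` of ★ `GPrimeData`
(K2E4-p11's contract statement VERBATIM): `∃ lam ≠ 0, ∀ Θ continuous with g ↦ Θ ↑↑g compactly supported, ∀ u, gState(univ, u) = lam · Φ^{st}_∞(t z⁰, Θ∘coe; archSingularTopFormFamily ν)`.
(★ (end-read) ∘ ★ (end-alg).) [cite: Rogawski1990, §8.2 Prop. 8.2.1 (a) pp. 118–119; §8.2 p. 124; §14.5 p. 238] -/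
theorem exists_gState_univ_eq
    (hα : ∀ i, α i ≠ 0) (hherm : ∀ i, (IsCMField.complexConj L (α i) : L) = α i)
    (νw : ∀ v : {w : InfinitePlace L // IsComplex w}, Measure (archLocal L 3 (Matrix.diagonal α) v)) (hνw : ∀ v, (νw v).IsHaarMeasure ∧ (νw v).IsMulRightInvariant)
    (e₁ e₂ : L) (h₁ : (IsCMField.complexConj L e₁ : L) * e₁ = 1) (h₂ : (IsCMField.complexConj L e₂ : L) * e₂ = 1) (hne : e₁ ≠ e₂)
    [∀ (w : {w : InfinitePlace L // IsComplex w}) (τ : Perm (Fin 3)), MeasurableSpace (archLocal L 3 (Matrix.diagonal (α ∘ ⇑τ)) w ⧸ Subgroup.centralizer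
      ({(⟨circleDiagonal 3 (wallPoint L e₁ e₂ h₁ h₂ w), circleDiagonal_mem_archLocal_diagonal L 3 (α ∘ ⇑τ) w (wallPoint L e₁ e₂ h₁ h₂ w)⟩ : archLocal L 3 (Matrix.diagonal (α ∘ ⇑τ)) w)} :
        Set (archLocal L 3 (Matrix.diagonal (α ∘ ⇑τ)) w)))]
    [∀ (w : {w : InfinitePlace L // IsComplex w}) (τ : Perm (Fin 3)), BorelSpace (archLocal L 3 (Matrix.diagonal (α ∘ ⇑τ)) w ⧸ Subgroup.centralizer
      ({(⟨circleDiagonal 3 (wallPoint L e₁ e₂ h₁ h₂ w), circleDiagonal_mem_archLocal_diagonal L 3 (α ∘ ⇑τ) w (wallPoint L e₁ e₂ h₁ h₂ w)⟩ : archLocal L 3 (Matrix.diagonal (α ∘ ⇑τ)) w)} :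
        Set (archLocal L 3 (Matrix.diagonal (α ∘ ⇑τ)) w)))]
    (νH : ∀ (w : {w : InfinitePlace L // IsComplex w}) (τ : Perm (Fin 3)), Measure (Subgroup.centralizer
      ({(⟨circleDiagonal 3 (wallPoint L e₁ e₂ h₁ h₂ w), circleDiagonal_mem_archLocal_diagonal L 3 (α ∘ ⇑τ) w (wallPoint L e₁ e₂ h₁ h₂ w)⟩ : archLocal L 3 (Matrix.diagonal (α ∘ ⇑τ)) w)} :
        Set (archLocal L 3 (Matrix.diagonal (α ∘ ⇑τ)) w))))
    (hνH : ∀ w τ, (νH w τ).IsHaarMeasure ∧ (νH w τ).IsInvInvariant)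
    (hpin : ∀ (w : {w : InfinitePlace L // IsComplex w}) (τ : Perm (Fin 3)), (w.1.embedding (α (τ 0))).re * (w.1.embedding (α (τ 2))).re < 0 →
        haveI : LocallyCompactSpace (archLocal L 3 (Matrix.diagonal (α ∘ ⇑τ)) w) := locallyCompactSpace_archLocal L 3 (Matrix.diagonal (α ∘ ⇑τ)) w
        haveI : SecondCountableTopology (archLocal L 3 (Matrix.diagonal (α ∘ ⇑τ)) w) := secondCountableTopology_archLocal L 3 (Matrix.diagonal (α ∘ ⇑τ)) w
        haveI : (νH w τ).IsHaarMeasure := (hνH w τ).1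
        haveI : (νH w τ).IsInvInvariant := (hνH w τ).2
        ∃ (ν : Measure (archLocal L 3 (Matrix.diagonal (α ∘ ⇑τ)) w)) (_ : ν.IsHaarMeasure) (_ : ν.IsMulRightInvariant),
          ∀ (Θ : Matrix (Fin 3) (Fin 3) ℂ → ℂ), ContDiff ℝ (⊤ : ℕ∞) Θ →
            HasCompactSupport (fun k : archLocal L 3 (Matrix.diagonal (α ∘ ⇑τ)) w => Θ ((k : GL (Fin 3) ℂ) : Matrix (Fin 3) (Fin 3) ℂ)) →
            ∀ (z₀ : Fin 3 → Circle) (h02' : z₀ 0 = z₀ 2) (h01' : z₀ 0 ≠ z₀ 1),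
              Tendsto (fun ψ : ℝ => deriv (fun ψ : ℝ => (2 * Real.sin ψ : ℂ) *
                  ∫ g, Θ (((g * ⟨circleDiagonal 3 (fun i => z₀ i * Circle.exp (![(1 : ℝ), 0, -1] i * ψ)),
                    circleDiagonal_mem_archLocal_diagonal L 3 (α ∘ ⇑τ) w _⟩ * g⁻¹ : archLocal L 3 (Matrix.diagonal (α ∘ ⇑τ)) w) : GL (Fin 3) ℂ) : Matrix (Fin 3) (Fin 3) ℂ) ∂(ν)) ψ)
                (𝓝[≠] 0)
                (𝓝 ((-1 : ℂ) * ∫ y, descConj (⟨circleDiagonal 3 z₀, circleDiagonal_mem_archLocal_diagonal L 3 (α ∘ ⇑τ) w z₀⟩ : archLocal L 3 (Matrix.diagonal (α ∘ ⇑τ)) w)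
                  (Subgroup.centralizer ({(⟨circleDiagonal 3 (wallPoint L e₁ e₂ h₁ h₂ w), circleDiagonal_mem_archLocal_diagonal L 3 (α ∘ ⇑τ) w (wallPoint L e₁ e₂ h₁ h₂ w)⟩ : archLocal L 3 (Matrix.diagonal (α ∘ ⇑τ)) w)} : Set (archLocal L 3 (Matrix.diagonal (α ∘ ⇑τ)) w)))
                  (forall_mem_centralizer_circleDiagonal_comm_of_wall L (α ∘ ⇑τ) w (wallPoint_zero_eq_two L e₁ e₂ h₁ h₂ w) (wallPoint_zero_ne_one L e₁ e₂ h₁ h₂ hne w) h02' h01')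
                  (fun k : archLocal L 3 (Matrix.diagonal (α ∘ ⇑τ)) w => Θ ((k : GL (Fin 3) ℂ) : Matrix (Fin 3) (Fin 3) ℂ)) y
                  ∂(quotientMeasure _ (νH w τ) (isClosed_coe_centralizer_singleton _) (ν)))))
    [∀ γ : arch (↥(maximalRealSubfield L)) L (IsCMField.complexConj L) 3 (Matrix.diagonal α), MeasurableSpace (arch (↥(maximalRealSubfield L)) L (IsCMField.complexConj L) 3 (Matrix.diagonal α) ⧸ Subgroup.centralizer ({γ} : Set (arch (↥(maximalRealSubfield L)) L (IsCMField.complexConj L) 3 (Matrix.diagonal α))))]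
    [∀ γ : arch (↥(maximalRealSubfield L)) L (IsCMField.complexConj L) 3 (Matrix.diagonal α), BorelSpace (arch (↥(maximalRealSubfield L)) L (IsCMField.complexConj L) 3 (Matrix.diagonal α) ⧸ Subgroup.centralizer ({γ} : Set (arch (↥(maximalRealSubfield L)) L (IsCMField.complexConj L) 3 (Matrix.diagonal α))))]
    (ν : Measure (arch (↥(maximalRealSubfield L)) L (IsCMField.complexConj L) 3 (Matrix.diagonal α))) [ν.IsHaarMeasure] [ν.IsMulRightInvariant]
    (χ : ℝ≥0∞) (hχ0 : χ ≠ 0) (hχ : χ ≠ ⊤) (hν : ν = χ • (Measure.pi νw).map (archPiEquivCM 3 L (Matrix.diagonal α)).symm)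
    (T' : ArchTransferFactor L (Matrix.diagonal α)) (μω : HeckeCharacter L)
    (hμω : ∀ x : ideleGroup ↥(maximalRealSubfield L), μω (AdeleRing.ideleBaseChange (↥(maximalRealSubfield L)) L x) = quadraticHeckeCharCM L x)
    (cT : ℂ) (hcT : cT ≠ 0) (hT : ∀ a b, T'.Δ a b = cT * archExplicitDelta L (Matrix.diagonal α) a μω b) :
    ∃ lam : ℂ, lam ≠ 0 ∧ ∀ (Θ : Matrix (Fin 3) (Fin 3) (mixedSpace L) → ℂ), Continuous Θ →
      HasCompactSupport (fun g : arch (↥(maximalRealSubfield L)) L (IsCMField.complexConj L) 3 (Matrix.diagonal α) => Θ ((g : GL (Fin 3) (mixedSpace L)) : Matrix (Fin 3) (Fin 3) (mixedSpace L))) →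
      ∀ u : {w : InfinitePlace L // IsComplex w} → Fin 2 → Circle,
        gState L α νw hνw e₁ e₂ h₁ h₂ hne νH hνH T' χ Θ Finset.univ u =
          lam * archStableOrbitalIntegral L 3 (Matrix.diagonal α) (Literature.NumberTheory.Weil1964.UnitaryArchTopForm.archSingularTopFormFamily L (Matrix.diagonal α) ν)
            (fun g : arch (↥(maximalRealSubfield L)) L (IsCMField.complexConj L) 3 (Matrix.diagonal α) => Θ ((g : GL (Fin 3) (mixedSpace L)) : Matrix (Fin 3) (Fin 3) (mixedSpace L)))
            (archDiagTorus L 3 α (wallPoint L e₁ e₂ h₁ h₂)) := by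
  obtain ⟨r, hr, hread⟩ := K2E4ArchGPrimeEndRead.exists_wallIntegral_eq_mul_classOrbitalIntegral L α hα hherm νw hνw e₁ e₂ h₁ h₂ hne νH hνH hpin ν χ hχ0 hχ hν
  exact K2E4ArchGPrimeEndAlg.exists_gState_univ_eq_of_wallIntegral L α νw hνw e₁ e₂ h₁ h₂ hne νH hνH ν χ T' μω hμω cT hT hα hherm hχ0 hχ hcT r hr hread

end Summit.HodgeConjecture.HodgeConjecture.Cruxes.H413.K2E4ArchGPrimeEnd

end
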